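import Literature.Computability.AlgebraicComplexity.DIP20HookLikeTails
import Literature.Computability.AlgebraicComplexity.DIP20PlethysmValuesRow3
import HarnessLib

/-!
# Dörfler–Ikenmeyer–Panova 2019, Lemma 3.7 DISCHARGED: the last tail `(3,3)` by the counting formula
# (4.4) and stabilisation of the tail counts

Topic `Literature/Computability/AlgebraicComplexity`; sibling proofs file (D-0014) of
`DIP20MultiplicityObstructions.lean` (named fact `DIP20_lem_3_7`) completing `DIP20HookLikeTails.lean`
(`DIP20_lem_3_7_of_ne_33`: the four hook-like tails `(3,1), (2,1), (1,1), (1)` by Ikenmeyer–Panova's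
Thm. 1.7(a); "NOT covered: the tail `(3,3)`"). No new facts.

J. Dörfler, C. Ikenmeyer, G. Panova, SIAM J. Appl. Algebra Geom. 4 (2020) = arXiv:1901.04576, Lemma 3.7
(arXiv p. 5; TeX `multobs.tex` L397 `{lem:vanishingpleth}`): "If `λ` is an `m`-partition of `dn` and
`λ̄ ∈ {(3,3),(3,1),(2,1),(1,1),(1)}`, then `a_λ(d[n]) = 0`" — for `(3,3)`: "Exactly the same calculation
[IP17, Thm. 1.10(a)] can be used to also prove the result for `(3,3)`".

**Route here** (not IP's limit-coefficient calculation): by the counting formula (4.4) (tree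
`DIP20_eq_4_4_holds`, expanded over `S_3`: `plethysmCoeff_fin_three_cast_eq_six_counts`),
`a_{(L,3,3)}(d[n])` is the alternating sum of the six tail counts
`c_{(L,3,3)}, c_{(L+1,2,3)}, c_{(L,4,2)}, c_{(L+2,3,1)}, c_{(L+1,4,1)}, c_{(L+2,2,2)}` (all at `(d,n)`,
`L + 6 = dn`). A tail count `c_{(x,y,z)}(d,n)` (multisets of `d` weak compositions of `n` with column
sums `(x,y,z)`) is STABLE: adding a copy of `(n,0,0)` is a bijection as soon as `d ≥ y+z`
(`dipMonomialCount_succ_d`), and raising every first coordinate by one is a bijection as soon as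
`n ≥ y+z` (`dipMonomialCount_succ_n`). Hence the alternating sum depends only on `(min(n,6), min(d,6))`,
and the `36` base values vanish (kernel evaluation through `dipMonomialCount_eq_L` of the sibling
`DIP20MonomialCounts.lean`). The case `n ∤ |λ|` (and `n = 0`) carries no highest-weight vector at all
(a weight pins the degree, `monWeight_eq_of_mem_weightSpace`).

Proved: `plethysmCoeff_rowDual_tail33_eq_zero` and **`DIP20_lem_3_7_holds : DIP20_lem_3_7`**.

HONEST FRAMING: toy-model plethysm arithmetic; nothing here bears on permanent versus determinant;
VP ≠ VNP is not proved.

## References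

* J. Dörfler, C. Ikenmeyer, G. Panova, SIAM J. Appl. Algebra Geom. 4 (2020) = arXiv:1901.04576,
  Lemma 3.7 (arXiv p. 5), eq. (4.3)–(4.4) (arXiv p. 9). [DorflerIkenmeyerPanova2020]
* C. Ikenmeyer, G. Panova, Adv. Math. 319 (2017), Thm. 1.7(a). [IkenmeyerPanova2017]
-/

open scoped BigOperators
open MvPolynomial

namespace Literature.Computability.AlgebraicComplexity

open _root_.Literature.NumberTheory.DiophantineGeometry

/-! ### Stabilisation of the tail counts `c_{(x,y,z)}(d,n)` -/

section Stabilisation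

/-- Coordinates of a multiset sum of vectors. [folklore] -/
private theorem msum_apply' {ℓ : ℕ} (M : Multiset (Fin ℓ → ℕ)) (i : Fin ℓ) :
    M.sum i = (M.map fun α => α i).sum := by
  induction M using Multiset.induction_on with
  | empty => simp
  | cons a M ih => simp [ih]

/-- A member of a multiset of vectors is bounded, coordinatewise, by the sum. [folklore] -/
private theorem apply_le_sum_apply {ℓ : ℕ} {M : Multiset (Fin ℓ → ℕ)} {α : Fin ℓ → ℕ} (hα : α ∈ M)
    (i : Fin ℓ) : α i ≤ M.sum i := by
  rw [msum_apply']
  have h : α i ∈ M.map (fun β => β i) := Multiset.mem_map_of_mem (fun β => β i) hα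
  exact Multiset.le_sum_of_mem h

/-- The number of members with nonzero tail is at most the total tail `Σ (α 1 + α 2)`. [folklore] -/
private theorem card_filter_tail_le (M : Multiset (Fin 3 → ℕ)) :
    Multiset.card (M.filter fun α => α 1 + α 2 ≠ 0) ≤ M.sum 1 + M.sum 2 := by
  induction M using Multiset.induction_on with
  | empty => simp
  | cons a M ih =>
    rw [Multiset.filter_cons, Multiset.card_add, Multiset.sum_cons, Pi.add_apply, Pi.add_apply]
    split_ifs with h
    · simp only [Multiset.card_singleton]
      omega
    · simp only [Multiset.card_zero, zero_add]
      omega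

/-- A weak `3`-composition of `n` with zero tail is `(n, 0, 0)`. [folklore] -/
private theorem eq_head_of_tail_eq_zero {n : ℕ} {α : Fin 3 → ℕ} (hsum : ∑ i, α i = n)
    (h : α 1 + α 2 = 0) : α = ![n, 0, 0] := by
  rw [Fin.sum_univ_three] at hsum
  funext i
  fin_cases i
  · simp; omega
  · simp; omega
  · simp; omega

/-- **`d`-stabilisation**: for `y + z ≤ d` (with `ν = (x, y, z)`), adding one copy of `(n,0,0)` is a
bijection from the multisets counted by `c_ν(d,n)` onto those counted by `c_{ν+(n,0,0)}(d+1,n)`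
(pigeonhole: a multiset of `d + 1` compositions with total tail `≤ d` contains `(n,0,0)`).
[cite: DorflerIkenmeyerPanova2020, eq. (4.3) (arXiv p. 9)] -/
theorem dipMonomialCount_succ_d (n d : ℕ) (ν : Fin 3 → ℕ) (hν : ν 1 + ν 2 ≤ d) :
    dipMonomialCount (ν + ![n, 0, 0]) (d + 1) n = dipMonomialCount ν d n := by
  classical
  set e : Fin 3 → ℕ := ![n, 0, 0] with he
  have hesum : ∑ i, e i = n := by simp [he, Fin.sum_univ_three]
  unfold dipMonomialCount
  refine Nat.card_congr
    { toFun := fun M => ⟨M.1.erase e, ?_⟩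
      invFun := fun M => ⟨e ::ₘ M.1, ?_⟩
      left_inv := ?_
      right_inv := ?_ }
  · -- `e ∈ M`, then erase
    obtain ⟨hcard, hmem, hsum⟩ := M.2
    have heM : e ∈ M.1 := by
      by_contra hne
      have hall : ∀ α ∈ M.1, α 1 + α 2 ≠ 0 := by
        intro α hα h0
        have hαe := eq_head_of_tail_eq_zero (hmem α hα) h0
        rw [hαe, ← he] at hα
        exact hne hα
      have hfilt : M.1.filter (fun α => α 1 + α 2 ≠ 0) = M.1 := Multiset.filter_eq_self.mpr hall
      have h1 := card_filter_tail_le M.1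
      rw [hfilt, hcard, hsum] at h1
      simp [he] at h1
      omega
    refine ⟨?_, fun α hα => hmem α (Multiset.mem_of_mem_erase hα), ?_⟩
    · rw [Multiset.card_erase_of_mem heM, hcard]
      rfl
    · have h2 : (e ::ₘ M.1.erase e).sum = M.1.sum := by rw [Multiset.cons_erase heM]
      rw [Multiset.sum_cons, hsum, add_comm] at h2
      exact add_right_cancel h2
  · obtain ⟨hcard, hmem, hsum⟩ := M.2
    refine ⟨by rw [Multiset.card_cons, hcard], fun α hα => ?_, by rw [Multiset.sum_cons, hsum, add_comm]⟩
    rcases Multiset.mem_cons.mp hα with rfl | hα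
    · exact hesum
    · exact hmem α hα
  · intro M
    apply Subtype.ext
    simp only
    obtain ⟨hcard, hmem, hsum⟩ := M.2
    have heM : e ∈ M.1 := by
      by_contra hne
      have hall : ∀ α ∈ M.1, α 1 + α 2 ≠ 0 := by
        intro α hα h0
        have hαe := eq_head_of_tail_eq_zero (hmem α hα) h0
        rw [hαe, ← he] at hα
        exact hne hα
      have hfilt : M.1.filter (fun α => α 1 + α 2 ≠ 0) = M.1 := Multiset.filter_eq_self.mpr hall
      have h1 := card_filter_tail_le M.1
      rw [hfilt, hcard, hsum] at h1
      simp [he] at h1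
      omega
    exact Multiset.cons_erase heM
  · intro M
    apply Subtype.ext
    simp only
    exact Multiset.erase_cons_head e M.1

/-- **`n`-stabilisation**: for `y + z ≤ n` (with `ν = (x, y, z)`), raising every first coordinate by
one is a bijection from the multisets counted by `c_ν(d,n)` onto those counted by
`c_{ν+(d,0,0)}(d,n+1)` (every composition of `n+1` in such a multiset has positive first coordinate).
[cite: DorflerIkenmeyerPanova2020, eq. (4.3) (arXiv p. 9)] -/
theorem dipMonomialCount_succ_n (n d : ℕ) (ν : Fin 3 → ℕ) (hν : ν 1 + ν 2 ≤ n) :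
    dipMonomialCount (ν + ![d, 0, 0]) d (n + 1) = dipMonomialCount ν d n := by
  classical
  set u : Fin 3 → ℕ := ![1, 0, 0] with hu
  have husum : ∑ i, u i = 1 := by simp [hu, Fin.sum_univ_three]
  have hsmul : ∀ m : ℕ, m • u = ![m, 0, 0] := fun m => by
    funext i; fin_cases i <;> simp [hu]
  unfold dipMonomialCount
  refine Nat.card_congr
    { toFun := fun M => ⟨M.1.map (fun α => α - u), ?_⟩
      invFun := fun M => ⟨M.1.map (fun α => α + u), ?_⟩
      left_inv := ?_
      right_inv := ?_ }
  · obtain ⟨hcard, hmem, hsum⟩ := M.2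
    -- every member has first coordinate ≥ 1
    have hge : ∀ α ∈ M.1, u ≤ α := by
      intro α hα i
      fin_cases i
      · have h1 := apply_le_sum_apply hα 1
        have h2 := apply_le_sum_apply hα 2
        have hs := hmem α hα
        rw [Fin.sum_univ_three] at hs
        rw [hsum] at h1 h2
        simp at h1 h2
        show 1 ≤ α 0
        omega
      · simp [hu]
      · simp [hu]
    refine ⟨by rw [Multiset.card_map, hcard], fun β hβ => ?_, ?_⟩
    · obtain ⟨α, hα, rfl⟩ := Multiset.mem_map.mp hβ
      have hs := hmem α hα
      have hle := hge α hα
      have : ∑ i, (α - u) i + ∑ i, u i = ∑ i, α i := by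
        rw [← Finset.sum_add_distrib]
        exact Finset.sum_congr rfl fun i _ => tsub_add_cancel_of_le (hle i)
      omega
    · have h1 : (M.1.map (fun α => α - u)).sum + Multiset.card M.1 • u = M.1.sum := by
        rw [← Multiset.sum_replicate, ← Multiset.map_const', ← Multiset.sum_map_add]
        have hm : M.1.map (fun α => α - u + u) = M.1.map (fun α => α) :=
          Multiset.map_congr rfl fun α hα => tsub_add_cancel_of_le (hge α hα)
        rw [hm, Multiset.map_id']
      rw [hcard, hsum, hsmul] at h1
      exact add_right_cancel h1
  · obtain ⟨hcard, hmem, hsum⟩ := M.2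
    refine ⟨by rw [Multiset.card_map, hcard], fun β hβ => ?_, ?_⟩
    · obtain ⟨α, hα, rfl⟩ := Multiset.mem_map.mp hβ
      have hs := hmem α hα
      simp only [Pi.add_apply, Finset.sum_add_distrib, hs, husum]
    · rw [Multiset.sum_map_add, Multiset.map_id', Multiset.map_const', Multiset.sum_replicate, hsum, hcard, hsmul]
  · intro M
    apply Subtype.ext
    simp only [Multiset.map_map, Function.comp_def]
    obtain ⟨hcard, hmem, hsum⟩ := M.2
    conv_rhs => rw [← Multiset.map_id M.1]
    refine Multiset.map_congr rfl fun α hα => ?_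
    have hle : u ≤ α := by
      intro i
      fin_cases i
      · have h1 := apply_le_sum_apply hα 1
        have h2 := apply_le_sum_apply hα 2
        have hs := hmem α hα
        rw [Fin.sum_univ_three] at hs
        rw [hsum] at h1 h2
        simp at h1 h2
        show 1 ≤ α 0
        omega
      · simp [hu]
      · simp [hu]
    exact tsub_add_cancel_of_le hle
  · intro M
    apply Subtype.ext
    simp only [Multiset.map_map, Function.comp_def, add_tsub_cancel_right, Multiset.map_id']

end Stabilisation

/-! ### The alternating sum of the six tail counts, and its stability -/

section AltSum

/-- **`d`-stability of the six-term combination** (`d ≥ 6`). [cite: DorflerIkenmeyerPanova2020, eq. (4.3) (arXiv p. 9)] -/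
theorem tail33_terms_succ_d (n d x : ℕ) (hd : 6 ≤ d) :
    (dipMonomialCount ![x + n, 3, 3] (d + 1) n : ℤ) - dipMonomialCount ![x + n + 1, 2, 3] (d + 1) n
      - dipMonomialCount ![x + n, 4, 2] (d + 1) n - dipMonomialCount ![x + n + 2, 3, 1] (d + 1) n
      + dipMonomialCount ![x + n + 1, 4, 1] (d + 1) n + dipMonomialCount ![x + n + 2, 2, 2] (d + 1) n =
    (dipMonomialCount ![x, 3, 3] d n : ℤ) - dipMonomialCount ![x + 1, 2, 3] d n
      - dipMonomialCount ![x, 4, 2] d n - dipMonomialCount ![x + 2, 3, 1] d n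
      + dipMonomialCount ![x + 1, 4, 1] d n + dipMonomialCount ![x + 2, 2, 2] d n := by
  have h := fun (ν : Fin 3 → ℕ) (hν : ν 1 + ν 2 ≤ d) => dipMonomialCount_succ_d n d ν hν
  have e1 : (![x, 3, 3] : Fin 3 → ℕ) + ![n, 0, 0] = ![x + n, 3, 3] := by funext i; fin_cases i <;> simp
  have e2 : (![x + 1, 2, 3] : Fin 3 → ℕ) + ![n, 0, 0] = ![x + n + 1, 2, 3] := by
    funext i; fin_cases i <;> simp; omega
  have e3 : (![x, 4, 2] : Fin 3 → ℕ) + ![n, 0, 0] = ![x + n, 4, 2] := by funext i; fin_cases i <;> simp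
  have e4 : (![x + 2, 3, 1] : Fin 3 → ℕ) + ![n, 0, 0] = ![x + n + 2, 3, 1] := by
    funext i; fin_cases i <;> simp; omega
  have e5 : (![x + 1, 4, 1] : Fin 3 → ℕ) + ![n, 0, 0] = ![x + n + 1, 4, 1] := by
    funext i; fin_cases i <;> simp; omega
  have e6 : (![x + 2, 2, 2] : Fin 3 → ℕ) + ![n, 0, 0] = ![x + n + 2, 2, 2] := by
    funext i; fin_cases i <;> simp; omega
  rw [← e1, ← e2, ← e3, ← e4, ← e5, ← e6, h _ (by simp; omega), h _ (by simp; omega),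
    h _ (by simp; omega), h _ (by simp; omega), h _ (by simp; omega), h _ (by simp; omega)]

/-- **`n`-stability of the six-term combination** (`n ≥ 6`). [cite: DorflerIkenmeyerPanova2020, eq. (4.3) (arXiv p. 9)] -/
theorem tail33_terms_succ_n (n d x : ℕ) (hn : 6 ≤ n) :
    (dipMonomialCount ![x + d, 3, 3] d (n + 1) : ℤ) - dipMonomialCount ![x + d + 1, 2, 3] d (n + 1)
      - dipMonomialCount ![x + d, 4, 2] d (n + 1) - dipMonomialCount ![x + d + 2, 3, 1] d (n + 1)
      + dipMonomialCount ![x + d + 1, 4, 1] d (n + 1) + dipMonomialCount ![x + d + 2, 2, 2] d (n + 1) =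
    (dipMonomialCount ![x, 3, 3] d n : ℤ) - dipMonomialCount ![x + 1, 2, 3] d n
      - dipMonomialCount ![x, 4, 2] d n - dipMonomialCount ![x + 2, 3, 1] d n
      + dipMonomialCount ![x + 1, 4, 1] d n + dipMonomialCount ![x + 2, 2, 2] d n := by
  have h := fun (ν : Fin 3 → ℕ) (hν : ν 1 + ν 2 ≤ n) => dipMonomialCount_succ_n n d ν hν
  have e1 : (![x, 3, 3] : Fin 3 → ℕ) + ![d, 0, 0] = ![x + d, 3, 3] := by funext i; fin_cases i <;> simp
  have e2 : (![x + 1, 2, 3] : Fin 3 → ℕ) + ![d, 0, 0] = ![x + d + 1, 2, 3] := by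
    funext i; fin_cases i <;> simp; omega
  have e3 : (![x, 4, 2] : Fin 3 → ℕ) + ![d, 0, 0] = ![x + d, 4, 2] := by funext i; fin_cases i <;> simp
  have e4 : (![x + 2, 3, 1] : Fin 3 → ℕ) + ![d, 0, 0] = ![x + d + 2, 3, 1] := by
    funext i; fin_cases i <;> simp; omega
  have e5 : (![x + 1, 4, 1] : Fin 3 → ℕ) + ![d, 0, 0] = ![x + d + 1, 4, 1] := by
    funext i; fin_cases i <;> simp; omega
  have e6 : (![x + 2, 2, 2] : Fin 3 → ℕ) + ![d, 0, 0] = ![x + d + 2, 2, 2] := by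
    funext i; fin_cases i <;> simp; omega
  rw [← e1, ← e2, ← e3, ← e4, ← e5, ← e6, h _ (by simp; omega), h _ (by simp; omega),
    h _ (by simp; omega), h _ (by simp; omega), h _ (by simp; omega), h _ (by simp; omega)]

/-- **The six-term combination vanishes** for all `n, d ≥ 1` with `dn ≥ 9` (`x = dn - 6 ≥ 3`): induction
down to `n, d ≤ 6` by the two stability theorems, and `36` kernel evaluations at the base.
[cite: DorflerIkenmeyerPanova2020, Lemma 3.7 (tail (3,3), arXiv p. 5)] -/
theorem tail33_terms_eq_zero : ∀ (n d : ℕ), 1 ≤ n → 1 ≤ d → 9 ≤ d * n →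
    (dipMonomialCount ![d * n - 6, 3, 3] d n : ℤ) - dipMonomialCount ![d * n - 6 + 1, 2, 3] d n
      - dipMonomialCount ![d * n - 6, 4, 2] d n - dipMonomialCount ![d * n - 6 + 2, 3, 1] d n
      + dipMonomialCount ![d * n - 6 + 1, 4, 1] d n + dipMonomialCount ![d * n - 6 + 2, 2, 2] d n = 0 := by
  -- reduce `n` to `≤ 6`
  suffices H : ∀ (n d : ℕ), 1 ≤ n → n ≤ 6 → 1 ≤ d → 9 ≤ d * n →
      (dipMonomialCount ![d * n - 6, 3, 3] d n : ℤ) - dipMonomialCount ![d * n - 6 + 1, 2, 3] d n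
        - dipMonomialCount ![d * n - 6, 4, 2] d n - dipMonomialCount ![d * n - 6 + 2, 3, 1] d n
        + dipMonomialCount ![d * n - 6 + 1, 4, 1] d n + dipMonomialCount ![d * n - 6 + 2, 2, 2] d n = 0 by
    intro n
    induction n with
    | zero => intro d hn; omega
    | succ m ih =>
      intro d hn hd hdn
      by_cases hm : m + 1 ≤ 6
      · exact H (m + 1) d hn hm hd hdn
      · have hm6 : 6 ≤ m := by omega
        have hmul : d * (m + 1) = d * m + d := Nat.mul_succ d m
        have h6 : d * 6 ≤ d * m := Nat.mul_le_mul_left d hm6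
        by_cases hdm : 9 ≤ d * m
        · have hx : d * (m + 1) - 6 = d * m - 6 + d := by omega
          rw [hx, tail33_terms_succ_n m d (d * m - 6) hm6]
          exact ih d (by omega) hd hdm
        · -- then `d = 1` and `m + 1 = 9`
          have hd1 : d = 1 := by omega
          subst hd1
          have hm8 : m = 8 := by omega
          subst hm8
          simp only [dipMonomialCount_eq_L]
          decide +kernel
  -- reduce `d` to `≤ 6`
  suffices H2 : ∀ (n d : ℕ), 1 ≤ n → n ≤ 6 → 1 ≤ d → d ≤ 6 → 9 ≤ d * n →
      (dipMonomialCount ![d * n - 6, 3, 3] d n : ℤ) - dipMonomialCount ![d * n - 6 + 1, 2, 3] d n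
        - dipMonomialCount ![d * n - 6, 4, 2] d n - dipMonomialCount ![d * n - 6 + 2, 3, 1] d n
        + dipMonomialCount ![d * n - 6 + 1, 4, 1] d n + dipMonomialCount ![d * n - 6 + 2, 2, 2] d n = 0 by
    intro n d hn hn6 hd
    induction d with
    | zero => omega
    | succ e ih =>
      intro hdn
      by_cases he : e + 1 ≤ 6
      · exact H2 n (e + 1) hn hn6 hd he hdn
      · have he6 : 6 ≤ e := by omega
        have hmul : (e + 1) * n = e * n + n := Nat.succ_mul e n
        have h6 : 6 * n ≤ e * n := Nat.mul_le_mul_right n he6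
        by_cases hen : 9 ≤ e * n
        · have hx : (e + 1) * n - 6 = e * n - 6 + n := by omega
          rw [hx, tail33_terms_succ_d n e (e * n - 6) he6]
          exact ih (by omega) hen
        · -- then `n = 1` and `e + 1 = 9`
          have hn1 : n = 1 := by omega
          subst hn1
          have he8 : e = 8 := by omega
          subst he8
          simp only [dipMonomialCount_eq_L]
          decide +kernel
  -- the 36 base cases
  intro n d hn hn6 hd hd6 hdn
  simp only [dipMonomialCount_eq_L]
  interval_cases n <;> interval_cases d <;> first | omega | decide +kernel

end AltSum

/-! ### Lemma 3.7, tail `(3,3)`, and the discharge -/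

section Tail33

/-- **`a_{(L,3,3)}(·[n]) = 0`** for every `n` and every `L ≥ 3`: the tail `(3,3)` of Lemma 3.7.
A nonzero highest-weight vector would pin `n ≥ 1` and `d` with `dn = L + 6` (a weight pins the degree);
then (4.4) expanded over `S_3` expresses `a` by the six tail counts, whose alternating sum vanishes
(`tail33_terms_eq_zero`). [cite: DorflerIkenmeyerPanova2020, Lemma 3.7 (tail (3,3), arXiv p. 5; TeX multobs.tex L397 {lem:vanishingpleth})] -/
theorem plethysmCoeff_rowDual_tail33_eq_zero (n : ℕ) (μ : Fin 3 → ℕ) (hμ : Antitone μ)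
    (h1 : μ 1 = 3) (h2 : μ 2 = 3) : plethysmCoeff ℂ (Fin 3) n (rowDual μ) = 0 := by
  classical
  haveI : Infinite ℂ := CharZero.infinite ℂ
  have h10 : μ 1 ≤ μ 0 := hμ (show (0 : Fin 3) ≤ 1 by decide)
  rw [plethysmCoeff, hwMultiplicity]
  by_contra hne
  -- a nonzero highest-weight vector pins the degree
  have hbot : highestWeightSpace (coordRep (Fin 3) ℂ n) (rowDual μ) ≠ ⊥ := by
    intro hb
    apply hne
    rw [hb, finrank_bot]
  obtain ⟨h, hh, hh0⟩ := (Submodule.ne_bot_iff _).mp hbot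
  obtain ⟨s, hsup⟩ := support_nonempty.mpr hh0
  have hw := monWeight_eq_of_mem_weightSpace (highestWeightSpace_le_weightSpace _ _ hh) hsup
  have hsize := size_monWeight s
  rw [hw, size_rowDual, neg_inj, Nat.cast_inj, Fin.sum_univ_three, h1, h2] at hsize
  -- hsize : μ 0 + 3 + 3 = n * s.degree
  set d := s.degree with hd
  have hn : 1 ≤ n := by
    rcases Nat.eq_zero_or_pos n with rfl | hn
    · rw [Nat.zero_mul] at hsize; omega
    · exact hn
  have hd1 : 1 ≤ d := by
    rcases Nat.eq_zero_or_pos d with hd0 | hd0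
    · rw [hd0, Nat.mul_zero] at hsize; omega
    · exact hd0
  have hmul : d * n = n * d := Nat.mul_comm d n
  have hdn : 9 ≤ d * n := by omega
  -- the counting formula, expanded over `S_3`, at the explicit row vector
  have hμv : μ = ![d * n - 6, 3, 3] := by
    funext i
    fin_cases i
    · show μ 0 = d * n - 6
      omega
    · exact h1
    · exact h2
  have hcount := plethysmCoeff_fin_three_cast_eq_six_counts (d * n - 6) 3 3 (n := n) (d := d)
    (by omega) (by omega) (le_refl 3) (by omega)
  have hC : ∀ (x y z : ℕ), countVecMultisetsL (weakCompsL 3 n) d [x, y, z] =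
      dipMonomialCount ![x, y, z] d n := by
    intro x y z
    rw [dipMonomialCount_eq_L]
    rfl
  simp only [hC, show (1 : ℕ) ≤ 3 from by norm_num, show (2 : ℕ) ≤ 3 from by norm_num, and_self,
    if_true, show (3 : ℕ) - 1 = 2 from rfl, show (3 : ℕ) - 2 = 1 from rfl, show (3 : ℕ) + 1 = 4 from rfl]
    at hcount
  have hzero := tail33_terms_eq_zero n d hn hd1 hdn
  have hval : (plethysmCoeff ℂ (Fin 3) n (rowDual ![d * n - 6, 3, 3]) : ℤ) = 0 := by
    rw [hcount]
    linarith [hzero]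
  apply hne
  rw [hμv]
  have hval' : plethysmCoeff ℂ (Fin 3) n (rowDual ![d * n - 6, 3, 3]) = 0 := by exact_mod_cast hval
  simpa [plethysmCoeff, hwMultiplicity] using hval'

/-- **Dörfler–Ikenmeyer–Panova 2020, Lemma 3.7, DISCHARGED**: the four hook-like tails by
`DIP20_lem_3_7_of_ne_33` (`DIP20HookLikeTails.lean`, Ikenmeyer–Panova Thm. 1.7(a)) and the tail `(3,3)` by
`plethysmCoeff_rowDual_tail33_eq_zero`. [cite: DorflerIkenmeyerPanova2020, Lemma 3.7 (arXiv p. 5; TeX multobs.tex L397 {lem:vanishingpleth}; held paper-arxiv-1901.04576 p0006.txt:L105 "Lemma 7")] -/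
theorem DIP20_lem_3_7_holds : DIP20_lem_3_7 := by
  intro n μ hμ ht
  by_cases h33 : (μ 1, μ 2) = (3, 3)
  · simp only [Prod.mk.injEq] at h33
    exact plethysmCoeff_rowDual_tail33_eq_zero n μ hμ h33.1 h33.2
  · exact DIP20_lem_3_7_of_ne_33 n μ hμ ht h33

end Tail33

end Literature.Computability.AlgebraicComplexity
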